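import Summits.BirchSwinnertonDyer.BirchSwinnertonDyer.Theorems.AdditiveBranchIMCGordTwoTwistedFrame
import Summits.BirchSwinnertonDyer.BirchSwinnertonDyer.Theorems.AdditiveBranchIMCGordTwoRankOneWanAnyRoadFlat
import Summits.BirchSwinnertonDyer.BirchSwinnertonDyer.Theorems.AdditiveBranchIMCTwistTypePartnerDataTwistedTwo
import Summits.BirchSwinnertonDyer.BirchSwinnertonDyer.Theorems.AdditiveBranchIMCGordTwoTwistedFlat
import Literature.NumberTheory.EllipticCurves.CastellaLiuWan2022.GreenbergDivisibilityAwayFromCyclotomicSemistableTwistRamified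
import Summits.BirchSwinnertonDyer.BirchSwinnertonDyer.Theorems.AdditiveBranchIMCGordTwoTwistedLooseDefs
import HarnessLib

/-!
# LOOSE VARIANT (LEAD g18, door C «loose SU prime» of LeadReport26 §4 / LeadReport27 §4.2; crux 19357 `three_field_road` and the pen's r₁ twin 19358):
# the ♭-inclusion chain `AdditiveBranchIMCGordTwoTwistedFlatAnyTwo.lean` (LEAD g18, p816235; any twist-type `2`) VERBATIM with the field hypothesis `TameRoadFieldTwisted W p q K` REPLACED by `TameRoadFieldTwistedLoose W p q K`
# (`AdditiveBranchIMCGordTwoTwistedLooseDefs.lean`, p816632: the twisted Wan prime WITHOUT Skinner–Urban's clause `p ∤ v_q(j)`). 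
# * `awayFromCyc_twisted_loose`, `greenbergInclusion_twisted_loose`, `flatInclusion_twisted_loose`.
# Theorems only (no definition, no named fact, no `sorry`); `--supports` 19357, helper only; 19357 / 19358 stay OPEN; BSD is proved for no curve.
-/

set_option autoImplicit false
set_option linter.dupNamespace false

noncomputable section

open scoped Classical
open NumberField IsDedekindDomain IsDedekindDomain.HeightOneSpectrum Rat.HeightOneSpectrum
open WeierstrassCurve Literature.NumberTheory.EllipticCurves
open Literature.NumberTheory.EllipticCurves.Rank1Residual
open Literature.NumberTheory.QuadraticFields
open Summit.BirchSwinnertonDyer.Rank1Residual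
open Summit.BirchSwinnertonDyer.Rank1Residual.Additive
open Summit.BirchSwinnertonDyer.BirchSwinnertonDyer.Theorems
open ThreeFieldRoadSupply

namespace Summit.BirchSwinnertonDyer.BirchSwinnertonDyer.Theorems.TwistedWanRoad

section FlatChain

open Literature.NumberTheory.EllipticCurves.ModularForms Literature.NumberTheory.EllipticCurves.Rank1Residual.Typed Field
open WanAnyRoad

/-- THE TWO-VARIABLE DIVISIBILITY AWAY FROM THE CYCLOTOMIC VARIABLE WITH ITS ANTICYCLOTOMIC RESTRICTION AT A TWISTED ROAD FIELD (port of
`WanAnyRoad.awayFromCyc_wanAny`), for a curve of cell (G-ord, `e = 2`) with `p ≥ 5`, `ρ̄` onto, odd additive primes `≠ p` of quadratic-twist type,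
NOT additive at `2`, at a twisted road field `K` for the road prime `q` with `p ∤ q + 1`: for every parametrisation `Dt` of level `N_E`, anticyclotomic
`(κ, γ)`, degree-one `𝔭 ∣ p`, `𝔭′ ≠ 𝔭` over `p`, embedding datum `ι′` inducing `𝔭`, `X_ac^∅(E_K)_{𝔭′}` `Λ`-torsion and every completing pair
`(κ₁, γ₁)`, a two-variable fraction `A/B` with `B(0,·) ≠ 0`, a non-zero `h` in the cyclotomic variable alone, a ♭-frame `(Ω_K′, Ω_p′, Q′)` and the
restriction `D` with `h·B·ch_{Λ₂}(X_Gr₂)·Λ^ur ⊆ (A)`, `A(0,·) = B(0,·)·D`, `D ≠ 0`, `(D) ⊆ (Q′)`. Proof: the SEMISTABLE partner `V₀ ≅ E^{(p*·d)}` with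
`q ∣ d` (p795652; the other primes of `d` divide `N_E`, are `≠ q`, hence split in `K`; `2` splits in `K`), print Thm. 8.2.1 ∘ JSW 6.1.6 and §6.1 in
the RAMIFIED-twist-prime reading (`h821`, `h61`) with the base-change clause (S4‴) `baseChange_nonsplit_of_twistedWanPrime`, hypothesis (T) from
`TameXGr₂Torsion.isTorsion_XGr₂_cellGordTwo`, clause (ii) from `exists_frame_and_restriction_twisted` (Hsieh Thm. B, twisted reading).
[cite: CastellaLiuWan2022, Thm. 8.2.1 (p. 85) and §6.1 (p. 51) (Forum Math. Sigma 10 (2022) e110)]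
[cite: JetchevSkinnerWan2017, Thm. 6.1.6 (arXiv:1512.06894 p. 26)] [cite: Hsieh2014, Thm. B (Doc. Math. 19 p. 712)] -/
theorem awayFromCyc_twisted_loose (hmodP : nonempty_modularParametrizationData)
    (hB : Hsieh2014.thmB_exists_isHsiehLFunction_coeff_norm_eq_one_unrPeriod_ramifiedTwistedSteinberg)
    (h821 : CastellaLiuWan2022.thm821_XGr₂_charIdeal_mul_le_awayFromCyc_semistableTwistRamified)
    (h61 : CastellaLiuWan2022.sec61_exists_isCastellaLiuWanLFunction₂_semistableTwistRamified)
    (W : WeierstrassCurve ℚ) [W.IsElliptic] [W.IsGloballyMinimal] (p : ℕ) [Fact p.Prime]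
    {q : ℕ} [hqF : Fact q.Prime] (K : Type) [Field K] [NumberField K]
    (hcell : N10.CellGordTwo W p) (hp5 : 5 ≤ p) (hsurj : Surj W p)
    (h2tt : ∀ r : Nat.Primes, (r : ℕ) = 2 → W.HasAdditiveReductionAt ((primesEquiv (R := ℤ)).symm r) →
      ∃ t : ℤ, (t = -1 ∨ t = 2 ∨ t = -2) ∧ ¬ (W.quadraticTwist (t : ℚ)).HasAdditiveReductionAt ((primesEquiv (R := ℤ)).symm r))
    (htt : ∀ r : Nat.Primes, (r : ℕ) ≠ 2 → W.HasAdditiveReductionAt ((primesEquiv (R := ℤ)).symm r) →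
      ¬ (W.quadraticTwist (((-1 : ℤ) ^ ((r : ℕ) / 2) * r : ℤ) : ℚ)).HasAdditiveReductionAt
        ((primesEquiv (R := ℤ)).symm r))
    (hK : TameRoadFieldTwistedLoose W p q K) (hcut : ¬ p ∣ q + 1) :
    ∀ (N : ℕ) [NeZero N] (Dt : ModularParametrizationData W N), W.conductorNorm ℤ = N →
    ∀ (κ : ZpExtension K p), κ.IsAnticyclotomic → ∀ (γ : Field.absoluteGaloisGroup K) [Fact (κ.IsTopGenerator γ)]
      (𝔭 : HeightOneSpectrum (𝓞 K)), ((p : ℕ) : 𝓞 K) ∈ 𝔭.asIdeal → 𝔭.asIdeal.ramificationIdx (𝓞 ℚ) = 1 →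
      𝔭.asIdeal.inertiaDeg (𝓞 ℚ) = 1 → ∀ (𝔭' : HeightOneSpectrum (𝓞 K)), ((p : ℕ) : 𝓞 K) ∈ 𝔭'.asIdeal → 𝔭' ≠ 𝔭 →
      ∀ (ι' : PadicAlgCl p ≃+* ℂ), SchneiderFree.BranchInducesPrime p ι' 𝔭 →
        Module.IsTorsion (IwasawaAlgebra p) (X11b.AcSelmer.XAc (W.baseChange K) p κ 𝔭' ∅ γ) →
        ∀ (κ₁ : ZpExtension K p) (γ₁ : Field.absoluteGaloisGroup K) [Fact (ZpExtension.IsTopGeneratorPair κ₁ κ γ₁ γ)],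
          ∃ (A B : PowerSeries (PowerSeries (PadicComplexInt p))) (h : PowerSeries (PadicComplexInt p))
            (ΩK' : ℂ) (Ωp' : ℂ_[p]) (Q' D : PowerSeries (PadicComplexInt p)),
            h ≠ 0 ∧ ΩK' ≠ 0 ∧ Ωp' ≠ 0 ∧ X11b.R1.IsBDPLFunctionInt p ι' 𝔭 κ γ Dt.f ΩK' Ωp' Q' ∧
            (∀ y ∈ (WeierstrassCurve.XGr₂.charIdeal (W.baseChange K) p κ₁ κ 𝔭' γ₁ γ).map
                (IwasawaAlgebra₂.toUnr₂ p (X11b.R1.toCpInt p)),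
              PowerSeries.map (PowerSeries.C : PadicComplexInt p →+* PowerSeries (PadicComplexInt p)) h * B * y ∈
                Ideal.span {A}) ∧
            PowerSeries.constantCoeff B ≠ 0 ∧ PowerSeries.constantCoeff A = PowerSeries.constantCoeff B * D ∧
            D ≠ 0 ∧ Ideal.span {D} ≤ Ideal.span {Q'} := by
  intro N _ Dt hN κ hκ γ hγ 𝔭 h𝔭 _ _ 𝔭' h𝔭' hne ι' hind htors κ₁ γ₁ hpair
  have hp2 : p ≠ 2 := by omega
  have hmod : exists_isNewformOf := exists_isNewformOf_of_nonempty_modularParametrizationData hmodP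
  -- the field data (twisted Wan prime `q`, ramified in the non-split class)
  obtain ⟨hKiq, -, hq, hcl, hsplitq, h2K, hpK⟩ := hK
  have hbc := baseChange_nonsplit_of_nonsplitClass W hq.2.1 hq.2.2.2 K hKiq hcl.1 hcl.2
  obtain ⟨hqp, hq2, haddq, hmultq⟩ := hq
  have hK2 : Module.finrank ℚ K = 2 := hKiq.1
  have hpsplit : ((Ideal.span {(p : ℤ)}).primesOver (𝓞 K)).ncard = 2 := hpK p Fact.out (dvd_refl p)
  -- the SEMISTABLE partner `V₀ ≅ E^{(p*·d)}` WITH `q ∣ d` (`q ∥ N_{V₀}`), dyadic twist factor included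
  have hmultq' : (W.quadraticTwist (((-1 : ℤ) ^ (q / 2) * q : ℤ) : ℚ)).HasMultiplicativeReductionAtPrime q := by
    have h := hmultq; rw [primeStar_eq] at h; exact h
  obtain ⟨V, iV, iVm, C, d, hCV, hpd, hqd, hdpr, hsq, hpN, hsurjV, hqNV⟩ :=
    TwistTypePartnerData.exists_semistable_partner_data_twisted_two W p hp5 hcell hsurj h2tt htt hqp hq2 haddq hmultq'
  haveI := iV
  haveI := iVm
  have hVW : ∃ C' : WeierstrassCurve.VariableChange ℚ, C' • W.quadraticTwist ((-1 : ℚ) ^ (p / 2) * p * d) = V :=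
    ⟨C, hCV⟩
  -- the primes of `d` other than `q` divide `N_E`, hence split in `K`
  have hsplitd : ∀ ℓ : ℕ, ℓ.Prime → (ℓ : ℤ) ∣ d → ℓ ≠ q → ((Ideal.span {(ℓ : ℤ)}).primesOver (𝓞 K)).ncard = 2 :=
    fun ℓ hℓ hℓd hℓq ↦ hsplitq ℓ hℓ (hdpr ℓ hℓ hℓd) hℓq
  -- `2` splits in the road field (a bad prime `≠ q` splits; `2` splits also when `2 ∤ N_E`)
  have h2split : ((Ideal.span {(2 : ℤ)}).primesOver (𝓞 K)).ncard = 2 := by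
    by_cases h2N : 2 ∣ W.conductorNorm ℤ
    · exact hsplitq 2 Nat.prime_two h2N (fun h ↦ hq2 h.symm)
    · exact h2K h2N
  have hd4 : d % 4 ≠ 1 → ((Ideal.span {(2 : ℤ)}).primesOver (𝓞 K)).ncard = 2 := fun _ ↦ h2split
  have h2V : ((Ideal.span {(2 : ℤ)}).primesOver (𝓞 K)).ncard ≠ 2 → 2 ∣ V.conductorNorm ℤ :=
    fun hne2 ↦ absurd h2split hne2
  have hNW : ((N : ℕ) : ℤ) = (W.conductorNorm ℤ : ℤ) := by rw [hN]
  have hq' : ∃ q' : ℕ, q'.Prime ∧ q' ∣ V.conductorNorm ℤ ∧ ((Ideal.span {(q' : ℤ)}).primesOver (𝓞 K)).ncard ≠ 2 :=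
    ⟨q, hqF.out, hqNV, Hsieh2014.ncard_primesOver_ne_two_of_dvd_discr K hK2 hqF.out hcl.1⟩
  have hirr : (V.baseChange K).HasIrreducibleModPGaloisRep p := irrK_of_surj V p hsurjV K hK2
  -- existence of CLW's imprimitive two-variable `L`-function as a pair `(A, C(p^k)·B)` (§6.1, ramified reading)
  obtain ⟨Ωinf, Cc, Ωp, S, k, A, B, hΩinf, hCc, -, -, hCLW, hB0⟩ :=
    h61 ι' V W K 𝔭 𝔭' κ₁ κ γ₁ γ Dt.isNewformOf (V.conductorNorm ℤ) d q hVW hd4 hpd hqF.out hq2 hqp hqd hqNV hcut hcl.1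
      hbc hsplitd hNW rfl hp2 hsq hpN hKiq hpsplit h𝔭 h𝔭' hne hind hq' h2V hirr hκ
  set B' : PowerSeries (PowerSeries (PadicComplexInt p)) :=
    PowerSeries.C (PowerSeries.C (((p : ℕ) : PadicComplexInt p) ^ k)) * B with hB'
  have hB'0 : PowerSeries.constantCoeff B' ≠ 0 := by
    rw [hB', map_mul, PowerSeries.constantCoeff_C]
    refine mul_ne_zero ?_ hB0
    rw [Ne, PowerSeries.ext_iff, not_forall]
    refine ⟨0, ?_⟩
    rw [PowerSeries.coeff_C, if_pos rfl, map_zero]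
    exact pow_ne_zero _ (by exact_mod_cast (Fact.out : p.Prime).ne_zero)
  -- (T): torsion of `X_Gr₂` (p714502; road-prime free)
  have hXtors : Module.IsTorsion (IwasawaAlgebra₂ p) ((W.baseChange K).XGr₂ p κ₁ κ 𝔭' γ₁ γ) :=
    TameXGr₂Torsion.isTorsion_XGr₂_cellGordTwo W p K hcell hp5 hsurj hKiq hpsplit κ₁ κ γ₁ γ 𝔭' h𝔭' htors
  -- (i): print Thm. 8.2.1 ∘ JSW 6.1.6 (ramified-twist-prime reading) at the pair `(A, B′)`
  obtain ⟨h, hh, hincl⟩ :=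
    h821 ι' V W K 𝔭 𝔭' κ₁ κ γ₁ γ Dt.isNewformOf (V.conductorNorm ℤ) d q hVW hd4 hpd hqF.out hq2 hqp hqd hqNV hcut hcl.1
      hbc hsplitd hNW rfl hp2 hsq hpN hKiq hpsplit h𝔭 h𝔭' hne hind hq' h2V hirr hκ hXtors Ωinf Cc Ωp A B' hΩinf hCc hCLW
      (X11b.R1.toCpInt p) (fun x ↦ X11b.R1.coe_toCpInt p x)
  -- (ii): the anticyclotomic restriction (twisted frame)
  obtain ⟨ΩK', Ωp', Q', D, hΩK', hΩp', hQ', hAB, hD0, hDQ'⟩ :=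
    exists_frame_and_restriction_twisted hB W p K hp5 hcell.2.1 hsurj hKiq hpsplit hqp hq2 hcl.1 hmultq hbc hsplitq hcut
      Dt hN κ hκ γ 𝔭 h𝔭 𝔭' ι' hind κ₁ γ₁ Ωinf Cc Ωp A B' hΩinf hCc hCLW
  exact ⟨A, B', h, ΩK', Ωp', Q', D, hh, hΩK', hΩp', hQ', hincl, hB'0, hAB, hD0, hDQ'⟩

/-- THE ANTICYCLOTOMIC SPECIALISATION OF THE TWO-VARIABLE GREENBERG CHARACTERISTIC IDEAL LIES IN THE ♭-FRAME'S IDEAL (twisted road field; port of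
`WanAnyRoad.greenbergInclusion_wanAny`, verbatim): for every ♭-datum with a ♭-frame `Q` and every completing pair there is `k` with `C(p^k)·w ∈ (Q)`
for every `w` in the specialisation `T₁ ↦ 0` of `ch_{Λ₂}(X_Gr₂(E_K)_{𝔭′})·Λ^ur`. Proof: `awayFromCyc_twisted`; `(Q′) = (Q)` by ideal rigidity across
♭-frames (`X11b.R1.span_singleton_eq_of_isBDPLFunctionInt`); the `T₁`-cancellation `TameAwayFromCyc.exists_C_pow_mul_mem_span_of_frac`.
[cite: CastellaLiuWan2022, Thm. 8.2.1 (p. 85) (Forum Math. Sigma 10 (2022) e110)] [cite: Wan2020RankinSelbergIMC, §7.5 (arXiv:1408.4044v5)] -/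
theorem greenbergInclusion_twisted_loose (hmodP : nonempty_modularParametrizationData)
    (hB : Hsieh2014.thmB_exists_isHsiehLFunction_coeff_norm_eq_one_unrPeriod_ramifiedTwistedSteinberg)
    (h821 : CastellaLiuWan2022.thm821_XGr₂_charIdeal_mul_le_awayFromCyc_semistableTwistRamified)
    (h61 : CastellaLiuWan2022.sec61_exists_isCastellaLiuWanLFunction₂_semistableTwistRamified)
    (W : WeierstrassCurve ℚ) [W.IsElliptic] [W.IsGloballyMinimal] (p : ℕ) [Fact p.Prime]
    {q : ℕ} [Fact q.Prime] (K : Type) [Field K] [NumberField K]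
    (hcell : N10.CellGordTwo W p) (hp5 : 5 ≤ p) (hsurj : Surj W p)
    (h2tt : ∀ r : Nat.Primes, (r : ℕ) = 2 → W.HasAdditiveReductionAt ((primesEquiv (R := ℤ)).symm r) →
      ∃ t : ℤ, (t = -1 ∨ t = 2 ∨ t = -2) ∧ ¬ (W.quadraticTwist (t : ℚ)).HasAdditiveReductionAt ((primesEquiv (R := ℤ)).symm r))
    (htt : ∀ r : Nat.Primes, (r : ℕ) ≠ 2 → W.HasAdditiveReductionAt ((primesEquiv (R := ℤ)).symm r) →
      ¬ (W.quadraticTwist (((-1 : ℤ) ^ ((r : ℕ) / 2) * r : ℤ) : ℚ)).HasAdditiveReductionAt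
        ((primesEquiv (R := ℤ)).symm r))
    (hK : TameRoadFieldTwistedLoose W p q K) (hcut : ¬ p ∣ q + 1) :
    ∀ (N : ℕ) [NeZero N] (Dt : ModularParametrizationData W N), W.conductorNorm ℤ = N →
    ∀ (κ : ZpExtension K p), κ.IsAnticyclotomic → ∀ (γ : Field.absoluteGaloisGroup K) [Fact (κ.IsTopGenerator γ)]
      (𝔭 : HeightOneSpectrum (𝓞 K)), ((p : ℕ) : 𝓞 K) ∈ 𝔭.asIdeal → 𝔭.asIdeal.ramificationIdx (𝓞 ℚ) = 1 →
      𝔭.asIdeal.inertiaDeg (𝓞 ℚ) = 1 → ∀ (𝔭' : HeightOneSpectrum (𝓞 K)), ((p : ℕ) : 𝓞 K) ∈ 𝔭'.asIdeal → 𝔭' ≠ 𝔭 →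
      ∀ (ι' : PadicAlgCl p ≃+* ℂ), SchneiderFree.BranchInducesPrime p ι' 𝔭 →
      ∀ (ΩK : ℂ) (Ωp : ℂ_[p]) (Q : PowerSeries (PadicComplexInt p)), ΩK ≠ 0 → Ωp ≠ 0 →
        X11b.R1.IsBDPLFunctionInt p ι' 𝔭 κ γ Dt.f ΩK Ωp Q →
        Module.IsTorsion (IwasawaAlgebra p) (X11b.AcSelmer.XAc (W.baseChange K) p κ 𝔭' ∅ γ) →
        ∀ (κ₁ : ZpExtension K p) (γ₁ : Field.absoluteGaloisGroup K) [Fact (ZpExtension.IsTopGeneratorPair κ₁ κ γ₁ γ)],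
          ∃ k : ℕ,
            ∀ w ∈ ((WeierstrassCurve.XGr₂.charIdeal (W.baseChange K) p κ₁ κ 𝔭' γ₁ γ).map
                (IwasawaAlgebra₂.toUnr₂ p (X11b.R1.toCpInt p))).map
                (PowerSeries.constantCoeff (R := PowerSeries (PadicComplexInt p))),
              PowerSeries.C (((p : ℕ) : PadicComplexInt p) ^ k) * w ∈ Ideal.span {Q} := by
  intro N _ Dt hN κ hκ γ hγ 𝔭 h𝔭 he hf 𝔭' h𝔭' hne ι' hind ΩK Ωp Q hΩK hΩp hBDP htors κ₁ γ₁ hpair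
  obtain ⟨A, B, h, ΩK', Ωp', Q', D, hh, hΩK', hΩp', hQ', hincl, hB0, hAB, hD0, hDQ'⟩ :=
    awayFromCyc_twisted_loose hmodP hB h821 h61 W p K hcell hp5 hsurj h2tt htt hK hcut N Dt hN κ hκ γ 𝔭 h𝔭 he hf 𝔭' h𝔭' hne ι'
      hind htors κ₁ γ₁
  have hp2 : p ≠ 2 := by omega
  -- `(Q′) = (Q)`: ideal rigidity across ♭-frames
  have hQQ' : Ideal.span ({Q'} : Set (PowerSeries (PadicComplexInt p))) = Ideal.span {Q} :=
    X11b.R1.span_singleton_eq_of_isBDPLFunctionInt hp2 hK.1 hκ hγ.out hΩK hΩK' hΩp hΩp' hBDP hQ'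
  obtain ⟨k, hk⟩ := TameAwayFromCyc.exists_C_pow_mul_mem_span_of_frac _ A B D hB0 hD0 hAB h hh hincl
  refine ⟨k, fun w hw ↦ ?_⟩
  rw [← hQQ']
  exact hDQ' (hk w hw)

/-- THE ♭-INCLUSION FOR UNIT-CONTENT FRAMES AT TORSION DATA OVER A TWISTED ROAD FIELD (port of `WanAnyRoad.flatInclusion_wanAny`, verbatim:
the Heegner clause is the predicate's seventh field): `Ch_Λ(X_ac^∅(E_K)_{𝔭′})·𝓞_{ℂ_p}⟦T⟧ ⊆ (Q)` for every unit-content ♭-frame `Q` at `Λ`-torsion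
data. Proof: `E(K)[p] = 0`, a completing generator pair, the tame local vanishing (`TameLocalVanishing.tameLocalVanishing_cellGordTwo`) and tame exact
control (`TameExactControl.tameExactControl_of_localVanishing`), `greenbergInclusion_twisted` at that pair, then
`TameSpecialization.S2L.charIdeal_XAc_map_le_span_of_twoVarSpec`. [cite: JetchevSkinnerWan2017, §3.4 Lemma 3.4.1 and Thm. 6.1.4–6.1.5 (arXiv:1512.06894 pp. 14–15, 26)]
[cite: SkinnerUrban2014, Prop. 3.2.8 (p. 23)] -/
theorem flatInclusion_twisted_loose (hmodP : nonempty_modularParametrizationData)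
    (hB : Hsieh2014.thmB_exists_isHsiehLFunction_coeff_norm_eq_one_unrPeriod_ramifiedTwistedSteinberg)
    (h821 : CastellaLiuWan2022.thm821_XGr₂_charIdeal_mul_le_awayFromCyc_semistableTwistRamified)
    (h61 : CastellaLiuWan2022.sec61_exists_isCastellaLiuWanLFunction₂_semistableTwistRamified)
    (W : WeierstrassCurve ℚ) [W.IsElliptic] [W.IsGloballyMinimal] (p : ℕ) [Fact p.Prime]
    {q : ℕ} [Fact q.Prime] (K : Type) [Field K] [NumberField K]
    (hcell : N10.CellGordTwo W p) (hp5 : 5 ≤ p) (hsurj : Surj W p)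
    (h2tt : ∀ r : Nat.Primes, (r : ℕ) = 2 → W.HasAdditiveReductionAt ((primesEquiv (R := ℤ)).symm r) →
      ∃ t : ℤ, (t = -1 ∨ t = 2 ∨ t = -2) ∧ ¬ (W.quadraticTwist (t : ℚ)).HasAdditiveReductionAt ((primesEquiv (R := ℤ)).symm r))
    (htt : ∀ r : Nat.Primes, (r : ℕ) ≠ 2 → W.HasAdditiveReductionAt ((primesEquiv (R := ℤ)).symm r) →
      ¬ (W.quadraticTwist (((-1 : ℤ) ^ ((r : ℕ) / 2) * r : ℤ) : ℚ)).HasAdditiveReductionAt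
        ((primesEquiv (R := ℤ)).symm r))
    (hK : TameRoadFieldTwistedLoose W p q K) (hcut : ¬ p ∣ q + 1) :
    ∀ (N : ℕ) [NeZero N] (Dt : ModularParametrizationData W N), W.conductorNorm ℤ = N →
    ∀ (κ : ZpExtension K p), κ.IsAnticyclotomic → ∀ (γ : Field.absoluteGaloisGroup K) [Fact (κ.IsTopGenerator γ)]
      (𝔭 : HeightOneSpectrum (𝓞 K)), ((p : ℕ) : 𝓞 K) ∈ 𝔭.asIdeal → 𝔭.asIdeal.ramificationIdx (𝓞 ℚ) = 1 →
      𝔭.asIdeal.inertiaDeg (𝓞 ℚ) = 1 → ∀ (𝔭' : HeightOneSpectrum (𝓞 K)), ((p : ℕ) : 𝓞 K) ∈ 𝔭'.asIdeal → 𝔭' ≠ 𝔭 →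
      ∀ (ι' : PadicAlgCl p ≃+* ℂ), SchneiderFree.BranchInducesPrime p ι' 𝔭 →
      ∀ (ΩK : ℂ) (Ωp : ℂ_[p]) (Q : PowerSeries (PadicComplexInt p)), ΩK ≠ 0 → Ωp ≠ 0 →
        X11b.R1.IsBDPLFunctionInt p ι' 𝔭 κ γ Dt.f ΩK Ωp Q →
        Module.IsTorsion (IwasawaAlgebra p) (X11b.AcSelmer.XAc (W.baseChange K) p κ 𝔭' ∅ γ) →
        GreenbergVatsal2000.HasUnitContent Q →
        (X11b.AcSelmer.XAc.charIdeal (W.baseChange K) p κ 𝔭' ∅ γ).map (PowerSeries.map (X11b.R1.toCpInt p)) ≤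
          Ideal.span {Q} := by
  intro N _ Dt hN κ hκ γ hγ 𝔭 h𝔭 he hf 𝔭' h𝔭' hne ι' hind ΩK Ωp Q hΩK hΩp hBDP htors hμ
  have hp : p.Prime := Fact.out
  have hp2 : p ≠ 2 := by omega
  haveI hEK : (W.baseChange K).IsElliptic := by rw [baseChange]; infer_instance
  -- `E(K)[p] = 0`
  have htor := Literature.NumberTheory.EllipticCurves.torsionBy_eq_bot_of_isImaginaryQuadratic W K hK.1 hp hp2 hsurj
  have hKp : ∀ P : (W.baseChange K).toAffine.Point, p • P = 0 → P = 0 := fun P hP => by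
    have hmem : P ∈ AddSubgroup.torsionBy (W.baseChange K).toAffine.Point (p : ℤ) :=
      AddSubgroup.torsionBy.nsmul_iff.mpr hP
    rw [htor] at hmem
    exact AddSubgroup.mem_bot.mp hmem
  -- the completing pair, tame local vanishing and tame exact control
  obtain ⟨κ₁, γ₁, hpair⟩ := TameGeneratorPair.exists_isTopGeneratorPair_of_isImaginaryQuadratic hK.1 κ γ hγ.out
  haveI hpairI : Fact (ZpExtension.IsTopGeneratorPair κ₁ κ γ₁ γ) := ⟨hpair⟩
  have hvan : ∀ m : (W.baseChange K).geomPrimaryTorsion p,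
      (∀ x : Field.absoluteGaloisGroup K, x ∈ ZpExtension.pairKer κ₁ κ → x ∈ GreenbergSelmer.inertia 𝔭' → x • m = m) →
        m = 0 := fun m hm =>
    TameLocalVanishing.tameLocalVanishing_cellGordTwo W p K hcell hp5 hK.1.1 (hK.2.2.2.2.2.2 p Fact.out (dvd_refl p))
      κ₁ κ 𝔭' h𝔭' m hm
  obtain ⟨m, hm⟩ :=
    TameExactControl.tameExactControl_of_localVanishing W p hp2 hsurj K hK.1 κ₁ κ γ₁ γ 𝔭' h𝔭' hvan
  -- the two-variable specialised inclusion at that pair, then the proved specialisation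
  have h2i := greenbergInclusion_twisted_loose hmodP hB h821 h61 W p K hcell hp5 hsurj h2tt htt hK hcut N Dt hN κ hκ γ 𝔭 h𝔭 he hf 𝔭'
    h𝔭' hne ι' hind ΩK Ωp Q hΩK hΩp hBDP htors κ₁ γ₁
  exact TameSpecialization.S2L.charIdeal_XAc_map_le_span_of_twoVarSpec (W.baseChange K) p κ₁ κ 𝔭' γ₁ γ hKp htors ⟨m, hm⟩
    (X11b.R1.toCpInt p) Q hμ h2i

end FlatChain

end Summit.BirchSwinnertonDyer.BirchSwinnertonDyer.Theorems.TwistedWanRoad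

end
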